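import Literature.AlgebraicGeometry.Resolution.AlterationsFibrationsAssembly
import Literature.AlgebraicGeometry.Resolution.AlterationsSemiStable
import HarnessLib

/-!
# De Jong's alteration theorem: 4.11–4.28 in three printed blocks (cuts at 4.12 and at 4.23)

Topic: `Literature/AlgebraicGeometry/Resolution`. The deep half 4.11–4.28 of the printed proof of
de Jong 1996, Thm. 4.1 (`DeJong1996NormalProjectiveStep`, `AlterationsInduction.lean`; after
`AlterationsReductionHolds.lean` the only unproved input of Thm. 4.1 over algebraically closed
fields) has been cut twice, independently:

* at **4.12** (`AlterationsFibrations.lean`): `DeJong1996FibrationReduction` (Lemma 4.11 with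
  4.12: fibring a normal projective pair in curves, situation (vi) a)–d),
  `DeJong1996.SituationVI`) and `DeJong1996NormalProjectiveStepVI` (4.13–4.28);
* at **4.23** (`AlterationsSemiStable.lean`): `DeJong1996ReductionToSemiStablePair` (4.11–4.22)
  and `DeJong1996SemiStablePairResolution` (4.23–4.28: resolving a semi-stable pair,
  `DeJong1996.SemiStablePair`).

This file isolates the MIDDLE block and glues the two cuts:

* `DeJong1996FibrationToSemiStablePair` — NAMED FACT, **4.13–4.22**: over an algebraically
  closed field, given Thm. 4.1 with its generically-étale clause in dimension `≤ d`, a pair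
  `(X, Z)` of dimension `d + 1` in situation (vi) is reduced — along generically étale
  alterations (4.4, 4.15) and enlargements of `Z` (4.9, 4.14, 4.22) — to pairs in Situation 4.23
  of the same dimension: "4.13. Lemma [a multisection `H` with three smooth points on every
  component of every geometric fibre] … 4.14 … It suffices to prove the theorem for the pair
  `(X, Z ∪ H)`, see 4.9 … (vi) e) … 4.15 [generically étale projective alterations `Y' → Y` and
  strict transforms] … 4.16 [Galois normalisation: (vi) f) `Z = ⋃ σᵢ(Y)`] … 4.17 [the moduli
  stack `M̄_{g,n}`, level `ℓ`, 2.24: (vi) g) a stable `n`-pointed curve `(𝒞, τ₁, …, τₙ)` over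
  `Y` with `β : 𝒞_U ≅ X_U`] … 4.18–4.21 [flattening 2.19 and the three-point Lemma 4.20: `β`
  extends to a morphism after a modification of `Y`] … 4.22 … We replace `X` by `𝒞` and `Z` by
  `τ₁(Y) ∪ … ∪ τₙ(Y) ∪ f⁻¹(D)`, see 4.4 and 4.9. At this point we apply the induction
  hypothesis … Pulling back the family `𝒞` to a family `𝒳` over `Y'` and applying 4.4 once
  again, we reduce to the situation described in 4.23". Its decomposition along 4.13 | 4.14–4.16 |
  4.17 | 4.18–4.21 | 4.22 lives in `AlterationsMultisection*.lean`, `AlterationsStrictTransform*.lean`,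
  `AlterationsStableModel*.lean`, `AlterationsRationalMapExtension.lean`, `AlterationsPreSemiStable*.lean`,
  assembled in `DeJong1996FibrationToSemiStablePair.of_printedLeaves`
  (`AlterationsStrongAlgClosedLeaves.lean`); see the docstring of the fact for its open leaves.
* PROVED glue: `DeJong1996NormalProjectiveStepVI.of_fibrationToSemiStablePair_of_resolution`
  (4.13–4.28 from 4.13–4.22 and 4.23–4.28),
  `DeJong1996ReductionToSemiStablePair.of_fibration_of_fibrationToSemiStablePair` (4.11–4.22
  from 4.11–4.12 and 4.13–4.22, by 4.4 and 2.20), the sanity implication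
  `DeJong1996FibrationToSemiStablePair.of_stepVI`, and the assembly
  `DeJong1996StrongAlgClosed.of_threeBlocks` — **Thm. 4.1 with its generically-étale clause over
  algebraically closed fields from the three printed blocks 4.11–4.12, 4.13–4.22, 4.23–4.28** —
  with `DeJong1996Strong`/`DeJong1996StrongPerfect`/`DeJong1996Projective` over all fields from
  these and the limit argument of 4.5 (`DeJong1996.FiniteSubextension45`).

## Sources

* A. J. de Jong, *Smoothness, semi-stability and alterations*, Publ. Math. IHÉS 83 (1996) 51–93:
  2.18–2.20, 2.24 (pp. 60–62), 4.4, 4.9 (pp. 66–67), Lemma 4.11–4.12 (pp. 67–69),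
  Lemma 4.13–4.22 (pp. 69–75), 4.23–4.28 (pp. 75–76).
-/

noncomputable section

open CategoryTheory AlgebraicGeometry TopologicalSpace Topology

namespace Literature.AlgebraicGeometry.Resolution

universe u

/-- NAMED FACT — **de Jong 1996, 4.13–4.22: from a fibration in curves to a semi-stable pair.**
Over an algebraically closed field `k`, assume Thm. 4.1 with its generically-étale clause for all
pairs over `k` of dimension `≤ d` (`DeJong1996.StatementUpToDim k d`; used at 4.22 for the base
`(Y, D)`, `dim Y = d`). Let `(X, Z)` be a pair over `k` of dimension `d + 1` in situation (vi)
(`DeJong1996.SituationVI`: (iii) `X` projective, (iv) `Z` the support of a divisor, (v) `X`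
normal, and `f : X → Y` a fibration in curves over a projective variety with (vi) a)–d)). Then
Thm. 4.1 with the clause for `(X, Z)` follows from Thm. 4.1 with the clause for all pairs in
Situation 4.23 over `k` of the same dimension (`DeJong1996.SemiStablePair f' g' D' τ` with
boundary `⋃ᵢ τᵢ(Y') ∪ f'⁻¹(D')`: `Y'` nonsingular projective, `D'` a strict normal crossings
divisor, `f'` a semi-stable curve smooth over `Y' ∖ D'`, `τᵢ` disjoint sections into the smooth
locus). The printed route: the multisection Lemma 4.13 and 4.14 ((vi) e), via 4.9), generically
étale projective alterations of the base and strict transforms (4.15), Galois normalisation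
(4.16, (vi) f)), the projective level-`ℓ` moduli scheme of stable `n`-pointed curves (4.17 with
2.24, (vi) g)), flattening (2.19) and the three-point Lemma 4.20 (4.18–4.21), and 4.22 (replace
`X` by `𝒞` and `Z` by `τ₁(Y) ∪ … ∪ τₙ(Y) ∪ f⁻¹(D)` by 4.4 and 4.9, apply the induction hypothesis
to `(Y, D)`, pull back to `Y'` and apply 4.4 once again). Users take
`(h : DeJong1996FibrationToSemiStablePair)`.

Status (split review, D-0026): this node is NOT to be split again and needs no new named fact —
its decomposition along the printed proof is in the tree with every piece of glue proved, and
it is literally `DeJong1996FibrationToSemiStablePair.of_printedLeaves`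
(`AlterationsStrongAlgClosedLeaves.lean`) applied to the four named facts still open below it,
each a printed statement with its own locator: `DeJong1996MultisectionHyperplane` (proof of
Lemma 4.13, pp. 69–70; `AlterationsMultisectionLocalStep.lean`), `DeJong1996GaloisNormalization`
(4.16, p. 71; `AlterationsStrictTransform.lean`), `DeJong1996StableExtension` (4.17 with 2.24,
pp. 62, 71–72; `AlterationsStableModelParts.lean`) and `DeJong1996RationalMapExtension`
(4.18–4.21, pp. 72–74; `AlterationsRationalMapExtension.lean`); the other inputs of the block
are discharged (`DeJong1996MultisectionEtaleNhd_holds`, `DeJong1996MultisectionGenericallyEtale_holds`,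
`DeJong1996StrictTransform_holds`, `DeJong1996PullbackFamilyIntegral_holds`,
`DeJong1996PreSemiStablePairToSemiStablePair_holds`). Its discharge
`DeJong1996FibrationToSemiStablePair_holds` is that term on the four `…_holds` once they land,
in a file downstream of `AlterationsStrongAlgClosedLeaves.lean` (the leaf files import this one).
[cite: DeJong1996, 4.13–4.22, pp. 69–75] -/
def DeJong1996FibrationToSemiStablePair : Prop :=
  ∀ (k : Type u) [Field k] [IsAlgClosed k] (d : ℕ), DeJong1996.StatementUpToDim k d →
    ∀ (X : Scheme.{u}) (fX : X ⟶ Spec (.of k)) (Z : Set X), DeJong1996.SituationVI fX Z →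
      topologicalKrullDim X = (d + 1 : ℕ) →
        (∀ (X' Y' : Scheme.{u}) (f' : X' ⟶ Y') (g' : Y' ⟶ Spec (.of k)) (D' : Set Y') (n : ℕ)
            (τ : Fin n → (Y' ⟶ X')), DeJong1996.SemiStablePair f' g' D' τ →
            topologicalKrullDim X' = topologicalKrullDim X →
              DeJong1996.ConclusionGenericallyEtale (f' ≫ g')
                (DeJong1996.semiStableBoundary f' D' τ)) →
          DeJong1996.ConclusionGenericallyEtale fX Z

/-! ## Glue -/

/-- **4.13–4.28 from its two printed parts**: the reduction of a pair in situation (vi) to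
semi-stable pairs (4.13–4.22, `DeJong1996FibrationToSemiStablePair`) and the resolution of
semi-stable pairs (4.23–4.28, `DeJong1996SemiStablePairResolution`) give
`DeJong1996NormalProjectiveStepVI`. [cite: DeJong1996, 4.13–4.28, pp. 69–76] -/
theorem DeJong1996NormalProjectiveStepVI.of_fibrationToSemiStablePair_of_resolution
    (h : DeJong1996FibrationToSemiStablePair.{u}) (hres : DeJong1996SemiStablePairResolution.{u}) :
    DeJong1996NormalProjectiveStepVI.{u} :=
  fun k _ _ d ih X fX Z hVI hdim =>
    h k d ih X fX Z hVI hdim fun X' Y' f' g' D' n τ hS _ => hres k X' Y' f' g' D' n τ hS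

/-- **4.11–4.22 from its two printed parts**: the fibration in curves (4.11–4.12,
`DeJong1996FibrationReduction`) followed by 4.13–4.22 (`DeJong1996FibrationToSemiStablePair`)
gives the reduction of normal projective pairs to semi-stable pairs
(`DeJong1996ReductionToSemiStablePair` of `AlterationsSemiStable.lean`), descending along the
generically étale alteration of 4.11 by 4.4 (`DeJong1996.ConclusionGenericallyEtale.of_isAlteration`),
which preserves the dimension (2.20, `IsAlteration.topologicalKrullDim_eq`).
[cite: DeJong1996, 4.11–4.22, pp. 67–75] -/
theorem DeJong1996ReductionToSemiStablePair.of_fibration_of_fibrationToSemiStablePair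
    (h₁ : DeJong1996FibrationReduction.{u}) (h₂ : DeJong1996FibrationToSemiStablePair.{u}) :
    DeJong1996ReductionToSemiStablePair.{u} := by
  intro k _ _ d ih X f Z hP hdim H
  haveI := hP.isIntegral
  haveI := hP.isProper
  have h1 : (1 : WithBot ℕ∞) ≤ topologicalKrullDim X := by
    rw [hdim]
    exact_mod_cast Nat.succ_le_succ (Nat.zero_le d)
  obtain ⟨X', φ, hφ, hφe, hVI⟩ := h₁ k X f Z hP h1
  have hdim' : topologicalKrullDim X' = topologicalKrullDim X := hφ.topologicalKrullDim_eq f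
  refine DeJong1996.ConclusionGenericallyEtale.of_isAlteration hφ hφe ?_
  refine h₂ k d ih X' (φ ≫ f) (φ ⁻¹' Z) hVI (by rw [hdim', hdim]) ?_
  intro X'' Y'' f'' g'' D'' n τ hS hdim''
  exact H X'' Y'' f'' g'' D'' n τ hS (hdim''.trans hdim')

/-- Sanity of the cut: 4.13–4.28 trivially gives 4.13–4.22. [folklore] -/
theorem DeJong1996FibrationToSemiStablePair.of_stepVI (h : DeJong1996NormalProjectiveStepVI.{u}) :
    DeJong1996FibrationToSemiStablePair.{u} :=
  fun k _ _ d ih X fX Z hVI hdim _ => h k d ih X fX Z hVI hdim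

/-! ## The assembly from the three blocks -/

/-- `DeJong1996NormalProjectiveStep` (4.11–4.28) from the three printed blocks 4.11–4.12,
4.13–4.22, 4.23–4.28. [cite: DeJong1996, 4.11–4.28, pp. 67–76] -/
theorem DeJong1996NormalProjectiveStep.of_threeBlocks (h₁ : DeJong1996FibrationReduction.{u})
    (h₂ : DeJong1996FibrationToSemiStablePair.{u}) (h₃ : DeJong1996SemiStablePairResolution.{u}) :
    DeJong1996NormalProjectiveStep.{u} :=
  DeJong1996NormalProjectiveStep.of_fibration_of_stepVI h₁
    (DeJong1996NormalProjectiveStepVI.of_fibrationToSemiStablePair_of_resolution h₂ h₃)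

/-- **`DeJong1996StrongAlgClosed` — de Jong 1996, Thm. 4.1 with its generically-étale clause over
algebraically closed fields — from the three printed blocks of 4.11–4.28**: Lemma 4.11 with 4.12
(`DeJong1996FibrationReduction`), 4.13–4.22 (`DeJong1996FibrationToSemiStablePair`) and
4.23–4.28 (`DeJong1996SemiStablePairResolution`); 4.3, 4.4, 4.6–4.10 and the induction on
`dim X` are proved (`DeJong1996StrongAlgClosed.of_step`, `AlterationsReductionHolds.lean`).
[cite: DeJong1996, 4.3–4.28, pp. 66–76] -/
theorem DeJong1996StrongAlgClosed.of_threeBlocks (h₁ : DeJong1996FibrationReduction.{u})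
    (h₂ : DeJong1996FibrationToSemiStablePair.{u}) (h₃ : DeJong1996SemiStablePairResolution.{u}) :
    DeJong1996StrongAlgClosed.{u} :=
  DeJong1996StrongAlgClosed.of_step (DeJong1996NormalProjectiveStep.of_threeBlocks h₁ h₂ h₃)

/-- Thm. 4.1 (i)+(ii) and its last sentence over every field from the limit argument of 4.5
(`DeJong1996.FiniteSubextension45`) and the three blocks. [cite: DeJong1996, Thm. 4.1, p. 66] -/
theorem DeJong1996Strong.of_finiteSubextension45_of_threeBlocks
    (H : DeJong1996.FiniteSubextension45.{u}) (h₁ : DeJong1996FibrationReduction.{u})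
    (h₂ : DeJong1996FibrationToSemiStablePair.{u}) (h₃ : DeJong1996SemiStablePairResolution.{u}) :
    DeJong1996Strong.{u} ∧ DeJong1996StrongPerfect.{u} :=
  DeJong1996Strong.of_finiteSubextension45_of_step H
    (DeJong1996NormalProjectiveStep.of_threeBlocks h₁ h₂ h₃)

/-- Thm. 4.1 (i)+(ii) over every field from 4.5 as a whole (`DeJong1996Descent`) and the three
blocks. [cite: DeJong1996, Thm. 4.1, p. 66] -/
theorem DeJong1996Strong.of_descent_of_threeBlocks (h45 : DeJong1996Descent.{u})
    (h₁ : DeJong1996FibrationReduction.{u}) (h₂ : DeJong1996FibrationToSemiStablePair.{u})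
    (h₃ : DeJong1996SemiStablePairResolution.{u}) : DeJong1996Strong.{u} :=
  DeJong1996Strong.of_descent_of_step h45 (DeJong1996NormalProjectiveStep.of_threeBlocks h₁ h₂ h₃)

/-- `DeJong1996Projective` (Thm. 4.1 (i)) from the limit argument of 4.5 and the three blocks.
[cite: DeJong1996, Thm. 4.1, p. 66] -/
theorem DeJong1996Projective.of_finiteSubextension45_of_threeBlocks
    (H : DeJong1996.FiniteSubextension45.{u}) (h₁ : DeJong1996FibrationReduction.{u})
    (h₂ : DeJong1996FibrationToSemiStablePair.{u}) (h₃ : DeJong1996SemiStablePairResolution.{u}) :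
    DeJong1996Projective.{u} :=
  (DeJong1996Strong.of_finiteSubextension45_of_threeBlocks H h₁ h₂ h₃).1.projective

end Literature.AlgebraicGeometry.Resolution

end
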